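import Literature.NumberTheory.NumberFields.PureCubicOrder
import HarnessLib

/-!
# The discriminant of a pure cubic field is at most `27 a² b²` in absolute value

Topic `Literature/NumberTheory/NumberFields`; sequel of `PureCubicOrder.lean`. For `ab` squarefree,
`ab ≠ 1`, and a cubic number field `K ∋ θ` with `θ³ = ab²`, Dedekind's basis `(1, θ, θ₂)`,
`θ₂ = θ²/b`, of the order `ℤ[θ, θ₂]` has trace matrix `[[3, 0, 0], [0, 0, 3ab], [0, 3ab, 0]]`
(trace form `Tr(x + yθ + zθ₂) = 3x` and the multiplication table `θ² = bθ₂`, `θθ₂ = ab`,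
`θ₂² = aθ`), hence discriminant `−27 a² b²`; since `1, θ, θ₂` are algebraic integers this is
`[𝓞_K : ℤ[θ, θ₂]]² · d_K`, so `|d_K| ≤ 27 a² b²` (in fact `d_K ∈ {−27a²b², −3a²b²}`, not needed here).

* `discr_eq_sq_mul_discr` — the discriminant of a family of algebraic integers indexed like the
  integral basis is `r² d_K` for an integer `r` (adapted from the tree's `facts_discr_eq_sq_mul`);
* `discr_dedekindBasis` — `discr(1, θ, θ₂) = −27 a² b²`;
* `abs_discr_le` — `|d_K| ≤ 27 a² b²`.

## References

* H. Cohen, *A Course in Computational Algebraic Number Theory*, GTM 138, Springer 1993, §6.4.5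
  (Thm. 6.4.13: discriminant of a pure cubic field). [Cohen1993]
-/

namespace Literature.NumberTheory.NumberFields

open scoped NumberField
open NumberField Module Polynomial

namespace PureCubic

variable {K : Type*} [Field K] [NumberField K]

/-- If a family `v` of algebraic integers of `K`, indexed like the integral basis of `K`, has
(rational) discriminant `D`, then `D = r² · d_K` for some integer `r` (the determinant of the integer
matrix of coordinates of `v` in the integral basis). [folklore] -/
theorem discr_eq_sq_mul_discr (v : Free.ChooseBasisIndex ℤ (𝓞 K) → K) (hv : ∀ i, IsIntegral ℤ (v i)) :
    ∃ r : ℤ, Algebra.discr ℚ v = r ^ 2 * NumberField.discr K := by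
  -- adapted from `Summits/…/LinnikCubicClassGroupsPureCubicClassGroupFBQPStubCubicFieldFacts.lean`
  classical
  have hint : ∀ i j, IsIntegral ℤ ((NumberField.integralBasis K).toMatrix v i j) := by
    intro i j
    have : v j = algebraMap (𝓞 K) K ⟨v j, (mem_integralClosure_iff ℤ K).mpr (hv j)⟩ := rfl
    rw [Module.Basis.toMatrix_apply, this, NumberField.integralBasis_repr_apply]
    exact isIntegral_algebraMap
  obtain ⟨r, hr⟩ := IsIntegrallyClosed.isIntegral_iff.1 (IsIntegral.det hint)
  refine ⟨r, ?_⟩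
  rw [← (NumberField.integralBasis K).toMatrix_map_vecMul v, Algebra.discr_of_matrix_vecMul,
    ← hr, ← NumberField.coe_discr]
  simp

/-- **The discriminant of Dedekind's basis**: `discr(1, θ, θ₂) = −27 a² b²` for `θ³ = ab²`,
`θ₂ = θ²/b`, `ab` squarefree, `ab ≠ 1`. [cite: Cohen1993, §6.4.5] -/
theorem discr_dedekindBasis (hdeg : finrank ℚ K = 3) {a b : ℕ} (hab : Squarefree (a * b)) (hab1 : a * b ≠ 1)
    {θ : K} (hθ : θ ^ 3 = ((a * b ^ 2 : ℕ) : K)) :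
    Algebra.discr ℚ ![(1 : K), θ, θ ^ 2 / (b : K)] = -27 * (a : ℚ) ^ 2 * (b : ℚ) ^ 2 := by
  have htr := trace_order hdeg hab hab1 hθ
  have hb : (b : K) ≠ 0 := Nat.cast_ne_zero.mpr (ne_zero_of_squarefree_mul hab).2
  -- the trace form on the six products
  have t : ∀ x y z : ℚ, Algebra.trace ℚ K ((x : K) + (y : K) * θ + (z : K) * (θ ^ 2 / (b : K))) = 3 * x := htr
  have e11 : Algebra.trace ℚ K (1 : K) = 3 := by
    have h := t 1 0 0; simp only [Rat.cast_one, Rat.cast_zero, zero_mul, add_zero] at h; simpa using h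
  have e12 : Algebra.trace ℚ K θ = 0 := by
    have h := t 0 1 0; simp only [Rat.cast_one, Rat.cast_zero, zero_mul, add_zero, zero_add, one_mul, mul_zero] at h
    exact h
  have e13 : Algebra.trace ℚ K (θ ^ 2 / (b : K)) = 0 := by
    have h := t 0 0 1; simp only [Rat.cast_one, Rat.cast_zero, zero_mul, zero_add, one_mul, mul_zero] at h
    exact h
  have e22 : Algebra.trace ℚ K (θ * θ) = 0 := by
    have h := t 0 0 b
    simp only [Rat.cast_zero, zero_mul, zero_add, mul_zero, Rat.cast_natCast] at h
    rwa [mul_div_cancel₀ _ hb, sq] at h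
  have e23 : Algebra.trace ℚ K (θ * (θ ^ 2 / (b : K))) = 3 * (a * b : ℕ) := by
    have h := t (a * b : ℕ) 0 0
    simp only [Rat.cast_zero, zero_mul, add_zero, Rat.cast_natCast] at h
    rwa [theta_mul_theta₂ hab hθ]
  have e32 : Algebra.trace ℚ K ((θ ^ 2 / (b : K)) * θ) = 3 * (a * b : ℕ) := by rw [mul_comm]; exact e23
  have e33 : Algebra.trace ℚ K ((θ ^ 2 / (b : K)) * (θ ^ 2 / (b : K))) = 0 := by
    have h := t 0 a 0
    simp only [Rat.cast_zero, zero_mul, zero_add, add_zero, Rat.cast_natCast, mul_zero] at h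
    rwa [← sq, theta₂_sq hab hθ]
  rw [Algebra.discr_def, Matrix.det_fin_three]
  simp only [Algebra.traceMatrix_apply, Algebra.traceForm_apply, Matrix.cons_val_zero, Matrix.cons_val_one,
    Matrix.cons_val_two, Matrix.head_cons, Matrix.tail_cons, mul_one, one_mul, e11, e12, e13, e22, e23, e32, e33]
  push_cast
  ring

/-- **`|d_K| ≤ 27 a² b²`** for a cubic field `K ∋ θ`, `θ³ = ab²`, `ab` squarefree, `ab ≠ 1`:
`−27a²b² = discr(1, θ, θ₂) = [𝓞_K : ℤ[θ, θ₂]]² · d_K`. [cite: Cohen1993, §6.4.5 (Thm. 6.4.13)] -/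
theorem abs_discr_le (hdeg : finrank ℚ K = 3) {a b : ℕ} (hab : Squarefree (a * b)) (hab1 : a * b ≠ 1)
    {θ : K} (hθ : θ ^ 3 = ((a * b ^ 2 : ℕ) : K)) : |NumberField.discr K| ≤ 27 * (a : ℤ) ^ 2 * (b : ℤ) ^ 2 := by
  classical
  have hcard : Fintype.card (Fin 3) = Fintype.card (Free.ChooseBasisIndex ℤ (𝓞 K)) := by
    rw [← finrank_eq_card_chooseBasisIndex, RingOfIntegers.rank, hdeg, Fintype.card_fin]
  set v : Fin 3 → K := ![(1 : K), θ, θ ^ 2 / (b : K)] with hv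
  have hvi : ∀ i, IsIntegral ℤ (v i) := by
    intro i
    fin_cases i
    · exact isIntegral_one
    · exact isIntegral_theta hθ
    · exact isIntegral_theta₂ hab hθ
  set e := (Fintype.equivOfCardEq hcard).symm with he
  obtain ⟨r, hr⟩ := discr_eq_sq_mul_discr (K := K) (v ∘ ⇑e) (fun i => hvi _)
  have hre : Algebra.discr ℚ (v ∘ ⇑e) = Algebra.discr ℚ v := by
    rw [Algebra.discr_def, Algebra.discr_def,
      show Algebra.traceMatrix ℚ (v ∘ ⇑e) = (Algebra.traceMatrix ℚ v).submatrix e e from by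
        ext i j; simp [Algebra.traceMatrix_apply], Matrix.det_submatrix_equiv_self]
  rw [hre, hv, discr_dedekindBasis hdeg hab hab1 hθ] at hr
  have hz : (-27 * (a : ℤ) ^ 2 * (b : ℤ) ^ 2 : ℤ) = r ^ 2 * NumberField.discr K := by exact_mod_cast hr
  obtain ⟨ha0, hb0⟩ := ne_zero_of_squarefree_mul hab
  have hab0 : (0 : ℤ) < (a : ℤ) ^ 2 * (b : ℤ) ^ 2 := by positivity
  have hr0 : r ≠ 0 := by
    rintro rfl
    simp only [ne_eq, zero_pow, OfNat.ofNat_ne_zero, not_false_eq_true, zero_mul, mul_eq_zero,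
      neg_eq_zero, OfNat.ofNat_ne_zero, false_or, pow_eq_zero_iff] at hz
    rcases hz with h | h <;> simp_all
  have h1 : 1 ≤ r ^ 2 := by have := sq_pos_of_ne_zero hr0; omega
  have hd := NumberField.discr_ne_zero K
  rw [abs_le]
  constructor <;> nlinarith [sq_nonneg (NumberField.discr K), mul_le_mul_of_nonneg_right h1 (abs_nonneg (NumberField.discr K)),
    abs_mul_abs_self (NumberField.discr K)]

end PureCubic

end Literature.NumberTheory.NumberFields
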